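import Summits.Ventures.QEC.Thresholds.ToricCodeThresholdKernelK8
import Literature.Probability.RandomPlanarGeometry.SAWFiniteMemoryKernelK10
import Literature.Probability.RandomPlanarGeometry.SAWFiniteMemoryZ3KernelK6
import HarnessLib

/-!
# Toric-code thresholds from the KERNEL-checked Pönitz–Tittmann bounds `μ(ℤ²) ≤ 2.7248` (memory 10)
# and `μ(ℤ³) ≤ 4.8075` (memory 6): `p_c > .0348` (perfect measurement), `y_c > .3669` (loss),
# `p_c > .0109` (noisy measurement, `q = p`) — unconditional, tier CERTIFIED (kernel)

Venture QEC, `Summits/Ventures/QEC/Thresholds/` (continues `ToricCodeThresholdKernelK8.lean`; LADDER item 03.PTMEM).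
Inputs, all with axioms `propext`/`Classical.choice`/`Quot.sound` (trie certificates checked by `decide +kernel`):
`SAW.Zd.connectiveConstant_two_le_27248` (`SAWFiniteMemoryKernelK10.lean`, `2885` states) and
`SAW.Zd.FiniteMemory3.connectiveConstant_three_le_48075` (`SAWFiniteMemoryZ3KernelK6.lean`, `715` states) — the values
of Pönitz–Tittmann 2000, Table 2 (`d = 2, k = 10`; `d = 3, k = 6`). Through the unconditional parametric theorems
`toricThreshold_connectiveConstant_le` (perfect measurement), `lossThreshold_inv_connectiveConstant` (loss) and
`phenomThreshold_connectiveConstant_three_le` (noisy measurement):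

| theorem | statement | tier |
|---|---|---|
| `toricThreshold_kernelK10`, `thresholdValue_27248_bounds`, `toricThreshold_0348`, `accuracyThreshold_gt_0348`, `hasThreshold_toric_0348`, `ToricCode.accuracyThreshold_minWeight_gt_0348`, `toric_decaysExponentially_0348` | perfect measurement, every min-weight decoder family: **`p_c > .0348`** (`.0348 < p₀(2.7248) < .0349`; kernel decimals so far `.0293 → .0322 → .0343`) | CERTIFIED (kernel), unconditional |
| `lossThreshold_kernelK10`, `loss_accuracyThreshold_gt_0366` | loss channel: **`y_c > .3669`** | CERTIFIED (kernel), unconditional |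
| `phenomThreshold_kernelZ3K6`, `thresholdValue_48075_bounds`, `phenom_accuracyThreshold_gt_0109`, `ToricCode.phenom_accuracyThreshold_stMinWeight_gt_0109`, `phenom_decaysExponentially_0109` | noisy measurement (`q = p`), every poly-bounded schedule and min-weight space-time decoder family: **`p_c > .0109`** (`.0109 < p₀(4.8075) < .0110`; kernel decimals so far `.0101 → .0106`) | CERTIFIED (kernel), unconditional |

The CHECKED-native values (`μ(ℤ²) ≤ 2.688`: `.0358`; `μ(ℤ³) ≤ 4.76`: `.0111`) remain the better decimals at their tier.
NOT A THEOREM ANYWHERE: DKLP's printed `.0373` / `.0114` (numerical connective constants, CLAIM). Theorem-only file.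

## References

* [DennisEtAl2002] E. Dennis, A. Kitaev, A. Landahl, J. Preskill, J. Math. Phys. 43 (2002) 4452,
  arXiv:quant-ph/0110143, §5.3 eqs. (saw_2), (saw_3), (threshold_2d)–(p_c_2d), (threshold_iso_num), (fail_2d), (fail_iso).
* [PonitzTittmann2000] A. Pönitz, P. Tittmann, Electron. J. Combin. 7 (2000) R21, Table 2.
* [DumerKovalevPryadko2015] I. Dumer, A. A. Kovalev, L. P. Pryadko, PRL 115 (2015) 050502, p. 5.
-/

noncomputable section

namespace Summit.Ventures.QEC.Thresholds

open Filter Topology Finset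
open Literature.InformationTheory.QuantumCodes
open Literature.InformationTheory.QuantumCodes.ToricCode
open Literature.Probability.RandomPlanarGeometry

/-! ### Perfect syndrome measurement: `p_c > .0348` -/

/-- **Toric-code threshold `≥ p₀(2.7248)`, UNCONDITIONAL, tier CERTIFIED (kernel)**, for every minimum-weight decoder
family (perfect measurement), from the kernel-checked memory-10 bound `μ(ℤ²) ≤ 2.7248`.
[cite: DennisEtAl2002, §5.3 eqs. (saw_2), (threshold_2d)] -/
theorem toricThreshold_kernelK10 {D : (L : ℕ) → ZDecoder (L + 1)}
    (hD : ∀ L, (D L).IsMinWeight (syn (L + 1)) (cycles (L + 1)) hammingNorm) :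
    IsThresholdLowerBound (toricFailureFamily D) (thresholdValue 2.7248) :=
  toricThreshold_connectiveConstant_le (by norm_num) SAW.Zd.connectiveConstant_two_le_27248 hD

/-- Decimal certificate: `.0348 < p₀(2.7248) < .0349`. [cite: DennisEtAl2002, §5.3 eq. (p_c_2d)] -/
theorem thresholdValue_27248_bounds :
    (0.0348 : ℝ) < thresholdValue 2.7248 ∧ thresholdValue 2.7248 < 0.0349 := by
  unfold thresholdValue
  constructor
  · have : Real.sqrt (1 - 1 / (2.7248 : ℝ) ^ 2) < 0.9304 := by
      rw [Real.sqrt_lt' (by norm_num)]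
      norm_num
    linarith
  · have : (0.9302 : ℝ) < Real.sqrt (1 - 1 / (2.7248 : ℝ) ^ 2) := by
      rw [Real.lt_sqrt (by norm_num)]
      norm_num
    linarith

/-- Decimal form: every `0 ≤ p < .0348` is below threshold (perfect measurement, every min-weight decoder family) —
UNCONDITIONAL, tier CERTIFIED (kernel). [cite: DennisEtAl2002, §4.3 and §5.3 eq. (threshold_2d)] -/
theorem toricThreshold_0348 {D : (L : ℕ) → ZDecoder (L + 1)}
    (hD : ∀ L, (D L).IsMinWeight (syn (L + 1)) (cycles (L + 1)) hammingNorm) :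
    IsThresholdLowerBound (toricFailureFamily D) 0.0348 :=
  (toricThreshold_kernelK10 hD).anti thresholdValue_27248_bounds.1.le

/-- **`p_c > .0348`** for every minimum-weight decoder family of the toric codes (perfect measurement) — UNCONDITIONAL,
tier CERTIFIED (kernel). [cite: DennisEtAl2002, §5.3 eq. (p_c_2d)] -/
theorem accuracyThreshold_gt_0348 {D : (L : ℕ) → ZDecoder (L + 1)}
    (hD : ∀ L, (D L).IsMinWeight (syn (L + 1)) (cycles (L + 1)) hammingNorm) :
    (0.0348 : ℝ) < accuracyThreshold (toricFailureFamily D) :=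
  lt_of_lt_of_le thresholdValue_27248_bounds.1
    (le_accuracyThreshold (toricThreshold_kernelK10 hD) ((thresholdValue_le_half _).trans (by norm_num)))

/-- The canonical minimum-weight decoders: `p_c > .0348` — UNCONDITIONAL, kernel. [cite: DennisEtAl2002, §5.3 eq. (p_c_2d)] -/
theorem ToricCode.accuracyThreshold_minWeight_gt_0348 :
    (0.0348 : ℝ) < accuracyThreshold (toricFailureFamily fun L => Decoder.minWeight (syn (L + 1)) hammingNorm) :=
  accuracyThreshold_gt_0348 fun L => ToricCode.isMinWeight_minWeight (L + 1)

/-- `HasThreshold` (PARTITION row-09 vocabulary) at the decimal `.0348` for every minimum-weight decoder family —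
UNCONDITIONAL, kernel. [cite: DennisEtAl2002, §4.3 and §5.3 eq. (p_c_2d)] -/
theorem hasThreshold_toric_0348 {D : (L : ℕ) → ZDecoder (L + 1)}
    (hD : ∀ L, (D L).IsMinWeight (syn (L + 1)) (cycles (L + 1)) hammingNorm) :
    HasThreshold (fun L p => (D L).logicalFailureProb (syn (L + 1)) (boundaries (L + 1))
      (iidLaw (bitLaw (min p.toNNReal 1) (min_le_right _ _)))) 0.0348 :=
  hasThreshold_of_isThresholdLowerBound (toricThreshold_0348 hD) (by norm_num)

/-- **Exponential decay at every `0 ≤ p ≤ .0348`**, UNCONDITIONAL, kernel, for every minimum-weight decoder family (walk-count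
constant at `ν = 2.725 > μ(ℤ²)`; `.0348 < p₀(2.725)`). [cite: DennisEtAl2002, §5.3 eq. (fail_2d)] -/
theorem toric_decaysExponentially_0348 {D : (L : ℕ) → ZDecoder (L + 1)}
    (hD : ∀ L, (D L).IsMinWeight (syn (L + 1)) (cycles (L + 1)) hammingNorm) {p : ℝ}
    (hp₀ : 0 ≤ p) (hpp : p ≤ 0.0348) :
    DecaysExponentially (toricFailureFamily D) p := by
  have hlt : SAW.Zd.connectiveConstant 2 < 2.725 :=
    lt_of_le_of_lt SAW.Zd.connectiveConstant_two_le_27248 (by norm_num)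
  obtain ⟨C, hC⟩ := exists_sawCountBound_of_connectiveConstant_lt hlt
  have hval : (0.0348 : ℝ) < thresholdValue 2.725 := by
    unfold thresholdValue
    have : Real.sqrt (1 - 1 / (2.725 : ℝ) ^ 2) < 0.9303 := by
      rw [Real.sqrt_lt' (by norm_num)]
      norm_num
    linarith
  exact toric_decaysExponentially_sawCountBound (by norm_num) hC hD hp₀ (lt_of_le_of_lt hpp hval)

/-! ### The loss channel: `y_c > .3669` -/

/-- **Loss threshold of the toric code `≥ 1/2.7248`** — UNCONDITIONAL, tier CERTIFIED (kernel).
[cite: DumerKovalevPryadko2015, p. 5 (toric erasure threshold)] -/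
theorem lossThreshold_kernelK10 : IsThresholdLowerBound erasureFamily (1 / 2.7248) := by
  refine lossThreshold_inv_connectiveConstant.anti ?_
  have h0 : 0 < SAW.Zd.connectiveConstant 2 := lt_of_lt_of_le one_pos (SAW.Zd.one_le_connectiveConstant 2)
  exact one_div_le_one_div_of_le h0 SAW.Zd.connectiveConstant_two_le_27248

/-- **`y_c > .3669`** for the toric code under the loss channel — UNCONDITIONAL, tier CERTIFIED (kernel).
[cite: DumerKovalevPryadko2015, p. 5] -/
theorem loss_accuracyThreshold_gt_0366 : (0.3669 : ℝ) < accuracyThreshold erasureFamily :=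
  lt_of_lt_of_le (by norm_num : (0.3669 : ℝ) < 1 / 2.7248)
    (le_accuracyThreshold lossThreshold_kernelK10 (by norm_num))

/-! ### Noisy syndrome measurement (`q = p`): `p_c > .0109` -/

/-- **Phenomenological toric threshold `≥ p₀(4.8075)`, UNCONDITIONAL, tier CERTIFIED (kernel)**, for every polynomially
bounded schedule of rounds and every minimum-weight space-time decoder family, from the kernel-checked memory-6 bound
`μ(ℤ³) ≤ 4.8075`. [cite: DennisEtAl2002, §5.3 eqs. (saw_3), (threshold_iso_num)] -/
theorem phenomThreshold_kernelZ3K6 {T : ℕ → ℕ} (hT : IsPolyBounded T)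
    {D : (L : ℕ) → STDecoder (L + 1) (T L)}
    (hD : ∀ L, (D L).IsMinWeight (stSyn (L + 1) (T L)) (stCycles (L + 1) (T L)) hammingNorm) :
    IsThresholdLowerBound (phenomFailureFamily T D) (thresholdValue 4.8075) :=
  phenomThreshold_connectiveConstant_three_le (by norm_num)
    SAW.Zd.FiniteMemory3.connectiveConstant_three_le_48075 hT hD

/-- Decimal certificate: `.0109 < p₀(4.8075) < .0110`. [cite: DennisEtAl2002, §5.3 eq. (threshold_iso_num)] -/
theorem thresholdValue_48075_bounds :
    (0.0109 : ℝ) < thresholdValue 4.8075 ∧ thresholdValue 4.8075 < 0.0110 := by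
  unfold thresholdValue
  constructor
  · have : Real.sqrt (1 - 1 / (4.8075 : ℝ) ^ 2) < 0.9782 := by
      rw [Real.sqrt_lt' (by norm_num)]
      norm_num
    linarith
  · have : (0.9780 : ℝ) < Real.sqrt (1 - 1 / (4.8075 : ℝ) ^ 2) := by
      rw [Real.lt_sqrt (by norm_num)]
      norm_num
    linarith

/-- **`p_c > .0109`** under phenomenological noise (`q = p`) for every minimum-weight space-time decoder family and every
polynomially bounded schedule — UNCONDITIONAL, tier CERTIFIED (kernel). [cite: DennisEtAl2002, §5.3 eq. (threshold_iso_num)] -/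
theorem phenom_accuracyThreshold_gt_0109 {T : ℕ → ℕ} (hT : IsPolyBounded T)
    {D : (L : ℕ) → STDecoder (L + 1) (T L)}
    (hD : ∀ L, (D L).IsMinWeight (stSyn (L + 1) (T L)) (stCycles (L + 1) (T L)) hammingNorm) :
    (0.0109 : ℝ) < accuracyThreshold (phenomFailureFamily T D) :=
  lt_of_lt_of_le thresholdValue_48075_bounds.1
    (le_accuracyThreshold (phenomThreshold_kernelZ3K6 hT hD) ((thresholdValue_le_half _).trans (by norm_num)))

/-- The canonical instance (`T(L) = L + 1` rounds, canonical minimum-weight space-time decoders): `p_c > .0109` —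
UNCONDITIONAL, kernel. [cite: DennisEtAl2002, §5.3 eq. (threshold_iso_num)] -/
theorem ToricCode.phenom_accuracyThreshold_stMinWeight_gt_0109 :
    (0.0109 : ℝ) < accuracyThreshold
      (phenomFailureFamily (fun L => L + 1) fun L => Decoder.minWeight (stSyn (L + 1) (L + 1)) hammingNorm) :=
  phenom_accuracyThreshold_gt_0109 isPolyBounded_succ fun L => ToricCode.isMinWeight_stMinWeight (L + 1) (L + 1)

/-- **Exponential decay at every `0 ≤ p ≤ .0109`** under phenomenological noise, UNCONDITIONAL, kernel (cubic walk-count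
constant at `ν = 4.81 > μ(ℤ³)`; `.0109 < p₀(4.81)`). [cite: DennisEtAl2002, §5.3 eq. (fail_iso)] -/
theorem phenom_decaysExponentially_0109 {T : ℕ → ℕ} (hT : IsPolyBounded T)
    {D : (L : ℕ) → STDecoder (L + 1) (T L)}
    (hD : ∀ L, (D L).IsMinWeight (stSyn (L + 1) (T L)) (stCycles (L + 1) (T L)) hammingNorm)
    {p : ℝ} (hp₀ : 0 ≤ p) (hpp : p ≤ 0.0109) :
    DecaysExponentially (phenomFailureFamily T D) p := by
  have hlt : SAW.Zd.connectiveConstant 3 < 4.81 :=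
    lt_of_le_of_lt SAW.Zd.FiniteMemory3.connectiveConstant_three_le_48075 (by norm_num)
  obtain ⟨C, hC⟩ := exists_sawCountBound3_of_connectiveConstant_lt hlt
  have hval : (0.0109 : ℝ) < thresholdValue 4.81 := by
    unfold thresholdValue
    have : Real.sqrt (1 - 1 / (4.81 : ℝ) ^ 2) < 0.9782 := by
      rw [Real.sqrt_lt' (by norm_num)]
      norm_num
    linarith
  exact phenom_decaysExponentially_sawCountBound3' (by norm_num) hC hT hD hp₀ (lt_of_le_of_lt hpp hval)

end Summit.Ventures.QEC.Thresholds

end
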